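import Literature.NumberTheory.DiophantineGeometry.TameAdditiveTypesAtTwoProofs
import Literature.NumberTheory.EllipticCurves.OggFormulaTameTypesTwoProofs
import Literature.NumberTheory.DiophantineGeometry.TateAlgorithmInvarianceProofs
import HarnessLib

/-!
# `Iₙ*` with `n ≥ 2` at `2` has `ord Δ ≥ n + 8` (so `f ≥ 4`); the additive types with `f₂ = 3` are
# `III` (`ord₂Δ = 4`), `I₁*` (`8`), `III*` (`10`), `II*` (`11`)
# (route `ManinLocalTwoThree`, crux C2 `ManinOddAtFour` stmt-BirchSwinnertonDyer-22967; cell bsd-f2-manin, toward an's S-an-60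
# `NegOneTwistConductorTwoMul` «f₂ = 3 ⟹ f₂(W ⊗ χ₋₄) = 4»; p2 gen 13)

The tree's `TameAdditiveTypesAtTwoProofs` bounds `ord Δ ≥ n + 7` on the `Iₙ*` branch (`n ≥ 1`) in residue characteristic `2`, from
the round-`m` orders `ord b₂ ≥ 2`, `ord b₄ ≥ m + 3`, `ord b₆ ≥ 2m + 4`, `ord b₈ ≥ 2m + 5`: `ord Δ ≥ min (2m+9, 3m+12, 4m+8, 3m+9)`.
For `m ≥ 1` this minimum is `2m + 9 = n + 8` at the exit `n = 2m + 1`, so `n + 7` is attained ONLY at `n = 1` (§1: the same loop,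
one exponent sharper from round `1` on).  Hence (§2; Ogg's formula is the tree's DEFINITION of `conductorExponent`) `Iₙ*` with `n ≥ 2`
has `f ≥ 4`, and the types with `f = 3` at an absolutely unramified `2`-adic place are exactly `III/4`, `I₁*/8`, `III*/10`, `II*/11`
(the other types being excluded by the tree's value sets `II ∈ {4,6,7}`, `III ∈ {4,6,8,9}`, `IV = 4`, `I₀* ∈ {8,9,10}`, `IV* = 8`,
`III* ∈ {10,12,14,15}`, `II* ∈ {11,12,14}`); §3: the same over `ℚ` at the place of `ℤ` above `2`.

HONEST FRAMING: local bookkeeping in print (Silverman *ATAEC* IV.9.4 Step 7; Papadopoulos 1993 Table IV), kernel-checked as the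
classification input of S-an-60.  Nothing about BSD or Manin's conjecture is proved; C2 OPEN.
[cite: SilvermanATAEC1994, IV.9.4 Step 7 (PDF pp. 345–346) and Table 4.1] [cite: Papadopoulos1993, Table IV (p = 2)]
-/

set_option autoImplicit false
-- lint-debt: the directory name repeats the summit name (sibling precedent `ManinLocalTwoThreeNegOneTwistConductorAtTwo.lean`)
set_option linter.dupNamespace false

noncomputable section

open Polynomial IsLocalRing
open IsDiscreteValuationRing hiding maximalIdeal
open Literature.NumberTheory.DiophantineGeometry Literature.NumberTheory.DiophantineGeometry.TateAlgorithm
  Literature.NumberTheory.DiophantineGeometry.TateAlgorithm.CharTwo Literature.NumberTheory.EllipticCurves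

namespace Summit.BirchSwinnertonDyer.BirchSwinnertonDyer.Theorems.ManinLocalTwoThree

/-! ## §1 The `Iₙ*` loop in residue characteristic `2`, one exponent sharper from round `1` on -/

section Loop

variable {R : Type*} [CommRing R] [IsDomain R] [IsDiscreteValuationRing R]

/-- **Round `m ≥ 1`, `2 ∈ 𝔪`: `π^{2m+9} ∣ Δ`** on a model with `π ∣ a₁, a₂`, `π^{m+2} ∣ a₃`, `π^{m+3} ∣ a₄`, `π^{2m+4} ∣ a₆`
(`min (2m+9, 3m+12, 4m+8, 3m+9) = 2m + 9` once `m ≥ 1`). [cite: SilvermanATAEC1994, IV.9.4 Step 7] -/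
theorem Δ_mem_pow_of_istarRoundA_of_one_le (h2 : (2 : R) ∈ maximalIdeal R) (V : WeierstrassCurve R) {m : ℕ}
    (hm : 1 ≤ m) (h1 : V.a₁ ∈ maximalIdeal R) (h₂ : V.a₂ ∈ maximalIdeal R) (h3 : V.a₃ ∈ maximalIdeal R ^ (m + 2))
    (h4 : V.a₄ ∈ maximalIdeal R ^ (m + 3)) (h6 : V.a₆ ∈ maximalIdeal R ^ (2 * m + 4)) :
    V.Δ ∈ maximalIdeal R ^ (2 * m + 9) := by
  have h11 : V.a₁ ∈ maximalIdeal R ^ 1 := by rwa [pow_one]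
  have h21 : V.a₂ ∈ maximalIdeal R ^ 1 := by rwa [pow_one]
  exact Δ_mem_pow_of_a_of_two_mem V h2 2 (m + 3) (2 * m + 4) (2 * m + 5) h11 h21 h3 h4 h6

/-- **The `Iₙ*` loop started at a round `m ≥ 1` keeps `π^{n+8} ∣ Δ`** (`n = istarIndexAux fuel m V`; perfect residue field,
`2 ∈ 𝔪`) — the tree's `Δ_mem_pow_istarIndexAux_of_two_mem` verbatim with the sharper round-A exponent.
[cite: SilvermanATAEC1994, IV.9.4 Step 7] -/
theorem Δ_mem_pow_istarIndexAux_of_one_le [PerfectField (ResidueField R)] (h2 : (2 : R) ∈ maximalIdeal R) :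
    ∀ (fuel m : ℕ) (V : WeierstrassCurve R), 1 ≤ m → V.a₁ ∈ maximalIdeal R → V.a₂ ∈ maximalIdeal R →
      V.a₂ ∉ maximalIdeal R ^ 2 → V.a₃ ∈ maximalIdeal R ^ (m + 2) →
      V.a₄ ∈ maximalIdeal R ^ (m + 3) → V.a₆ ∈ maximalIdeal R ^ (2 * m + 4) →
      V.Δ ∈ maximalIdeal R ^ (istarIndexAux fuel m V + 8) := by
  classical
  intro fuel
  induction fuel with
  | zero =>
    intro m V hm h1 h₂ _ h3 h4 h6
    rw [istarIndexAux_zero]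
    exact Ideal.pow_le_pow_right (by omega) (Δ_mem_pow_of_istarRoundA_of_one_le h2 V hm h1 h₂ h3 h4 h6)
  | succ k ih =>
    intro m V hm h1 h₂ h2n h3 h4 h6
    rw [istarIndexAux_succ]
    dsimp only
    by_cases hq1 : distinctRootCount
        (X ^ 2 + C (redCoeff V.a₃ (m + 2)) * X - C (redCoeff V.a₆ (2 * m + 4))) = 2
    · rw [if_pos hq1, show 2 * m + 1 + 8 = 2 * m + 9 by omega]
      exact Δ_mem_pow_of_istarRoundA_of_one_le h2 V hm h1 h₂ h3 h4 h6
    rw [if_neg hq1]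
    have hexA : ∃ C : WeierstrassCurve.VariableChange R, C.u = 1 ∧
        (C • V).a₁ ∈ maximalIdeal R ∧ (C • V).a₂ ∈ maximalIdeal R ∧
        (C • V).a₃ ∈ maximalIdeal R ^ (m + 3) ∧ (C • V).a₄ ∈ maximalIdeal R ^ (m + 3) ∧
        (C • V).a₆ ∈ maximalIdeal R ^ (2 * m + 5) :=
      exists_variableChange_istarA_of_perfectField h1 h₂ h3 h4 h6 hq1
    rw [dif_pos hexA]
    obtain ⟨hu1, hA₁, hA₂, hA₃, hA₄, hA₆⟩ := hexA.choose_spec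
    set V1 := hexA.choose • V with hV1
    have hΔ1 : V1.Δ = V.Δ := Δ_smul_of_u_eq_one hu1 _
    have hA₂n : V1.a₂ ∉ maximalIdeal R ^ 2 :=
      OggBound.a₂_not_mem_sq_of_smul hu1 h1 h₂ h2n (Ideal.pow_le_pow_right (by omega) h3)
        (Ideal.pow_le_pow_right (by omega) h4) (Ideal.pow_le_pow_right (by omega) h6) hA₁ hA₂
        (Ideal.pow_le_pow_right (by omega) hA₃) (Ideal.pow_le_pow_right (by omega) hA₄)
        (Ideal.pow_le_pow_right (by omega) hA₆)
    by_cases hq2 : distinctRootCount (C (redCoeff V1.a₂ 1) * X ^ 2 +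
        C (redCoeff V1.a₄ (m + 3)) * X + C (redCoeff V1.a₆ (2 * m + 5))) = 2
    · rw [if_pos hq2, ← hΔ1, show 2 * m + 2 + 8 = 2 * m + 10 by omega]
      exact Δ_mem_pow_of_istarRoundB_of_two_mem h2 V1 m hA₁ hA₂ hA₃ hA₄ hA₆
    rw [if_neg hq2]
    have hexB : ∃ C : WeierstrassCurve.VariableChange R, C.u = 1 ∧
        (C • V1).a₁ ∈ maximalIdeal R ∧ (C • V1).a₂ ∈ maximalIdeal R ∧
        (C • V1).a₃ ∈ maximalIdeal R ^ (m + 3) ∧ (C • V1).a₄ ∈ maximalIdeal R ^ (m + 4) ∧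
        (C • V1).a₆ ∈ maximalIdeal R ^ (2 * m + 6) :=
      exists_variableChange_istarB_of_perfectField hA₁ hA₂ hA₂n hA₃ hA₄ hA₆ hq2
    rw [dif_pos hexB]
    obtain ⟨hu2, hB₁, hB₂, hB₃, hB₄, hB₆⟩ := hexB.choose_spec
    set V2 := hexB.choose • V1 with hV2
    have hΔ2 : V2.Δ = V.Δ := (Δ_smul_of_u_eq_one hu2 _).trans hΔ1
    have hB₂n : V2.a₂ ∉ maximalIdeal R ^ 2 :=
      OggBound.a₂_not_mem_sq_of_smul hu2 hA₁ hA₂ hA₂n (Ideal.pow_le_pow_right (by omega) hA₃)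
        (Ideal.pow_le_pow_right (by omega) hA₄) (Ideal.pow_le_pow_right (by omega) hA₆) hB₁ hB₂
        (Ideal.pow_le_pow_right (by omega) hB₃) (Ideal.pow_le_pow_right (by omega) hB₄)
        (Ideal.pow_le_pow_right (by omega) hB₆)
    have key := ih (m + 1) V2 (by omega) hB₁ hB₂ hB₂n hB₃ hB₄
      (by rw [show 2 * (m + 1) + 4 = 2 * m + 6 by ring]; exact hB₆)
    rw [hΔ2] at key
    exact key

/-- **The `Iₙ*` loop from round `0` keeps `π^{n+8} ∣ Δ` UNLESS it exits at `n = 1`** (round `0` exits `n = 1`, or `n = 2` with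
`ord Δ ≥ 10`, or hands over to round `1`). [cite: SilvermanATAEC1994, IV.9.4 Step 7] -/
theorem Δ_mem_pow_istarIndexAux_zero_of_ne_one [PerfectField (ResidueField R)] (h2 : (2 : R) ∈ maximalIdeal R)
    (fuel : ℕ) (V : WeierstrassCurve R) (h1 : V.a₁ ∈ maximalIdeal R) (h₂ : V.a₂ ∈ maximalIdeal R)
    (h2n : V.a₂ ∉ maximalIdeal R ^ 2) (h3 : V.a₃ ∈ maximalIdeal R ^ 2) (h4 : V.a₄ ∈ maximalIdeal R ^ 3)
    (h6 : V.a₆ ∈ maximalIdeal R ^ 4) (hne : istarIndexAux fuel 0 V ≠ 1) :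
    V.Δ ∈ maximalIdeal R ^ (istarIndexAux fuel 0 V + 8) := by
  classical
  cases fuel with
  | zero =>
    rw [istarIndexAux_zero]
    have h := Δ_mem_pow_of_istarRoundA_of_two_mem h2 V 0 h1 h₂ (by simpa using h3) (by simpa using h4)
      (by simpa using h6)
    simpa using h
  | succ k =>
    rw [istarIndexAux_succ] at hne ⊢
    dsimp only at hne ⊢
    by_cases hq1 : distinctRootCount
        (X ^ 2 + C (redCoeff V.a₃ (0 + 2)) * X - C (redCoeff V.a₆ (2 * 0 + 4))) = 2
    · exact absurd (by rw [if_pos hq1]) hne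
    rw [if_neg hq1] at hne ⊢
    have hexA : ∃ C : WeierstrassCurve.VariableChange R, C.u = 1 ∧
        (C • V).a₁ ∈ maximalIdeal R ∧ (C • V).a₂ ∈ maximalIdeal R ∧
        (C • V).a₃ ∈ maximalIdeal R ^ (0 + 3) ∧ (C • V).a₄ ∈ maximalIdeal R ^ (0 + 3) ∧
        (C • V).a₆ ∈ maximalIdeal R ^ (2 * 0 + 5) :=
      exists_variableChange_istarA_of_perfectField h1 h₂ (by simpa using h3) (by simpa using h4)
        (by simpa using h6) hq1
    rw [dif_pos hexA] at hne ⊢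
    obtain ⟨hu1, hA₁, hA₂, hA₃, hA₄, hA₆⟩ := hexA.choose_spec
    set V1 := hexA.choose • V with hV1
    have hΔ1 : V1.Δ = V.Δ := Δ_smul_of_u_eq_one hu1 _
    have hA₂n : V1.a₂ ∉ maximalIdeal R ^ 2 :=
      OggBound.a₂_not_mem_sq_of_smul hu1 h1 h₂ h2n (Ideal.pow_le_pow_right (by omega) h3)
        (Ideal.pow_le_pow_right (by omega) h4) (Ideal.pow_le_pow_right (by omega) h6) hA₁ hA₂
        (Ideal.pow_le_pow_right (by omega) hA₃) (Ideal.pow_le_pow_right (by omega) hA₄)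
        (Ideal.pow_le_pow_right (by omega) hA₆)
    by_cases hq2 : distinctRootCount (C (redCoeff V1.a₂ 1) * X ^ 2 +
        C (redCoeff V1.a₄ (0 + 3)) * X + C (redCoeff V1.a₆ (2 * 0 + 5))) = 2
    · rw [if_pos hq2, ← hΔ1]
      have h := Δ_mem_pow_of_istarRoundB_of_two_mem h2 V1 0 hA₁ hA₂ hA₃ hA₄ hA₆
      simpa using h
    rw [if_neg hq2]
    have hexB : ∃ C : WeierstrassCurve.VariableChange R, C.u = 1 ∧
        (C • V1).a₁ ∈ maximalIdeal R ∧ (C • V1).a₂ ∈ maximalIdeal R ∧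
        (C • V1).a₃ ∈ maximalIdeal R ^ (0 + 3) ∧ (C • V1).a₄ ∈ maximalIdeal R ^ (0 + 4) ∧
        (C • V1).a₆ ∈ maximalIdeal R ^ (2 * 0 + 6) :=
      exists_variableChange_istarB_of_perfectField hA₁ hA₂ hA₂n hA₃ hA₄ hA₆ hq2
    rw [dif_pos hexB]
    obtain ⟨hu2, hB₁, hB₂, hB₃, hB₄, hB₆⟩ := hexB.choose_spec
    set V2 := hexB.choose • V1 with hV2
    have hΔ2 : V2.Δ = V.Δ := (Δ_smul_of_u_eq_one hu2 _).trans hΔ1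
    have hB₂n : V2.a₂ ∉ maximalIdeal R ^ 2 :=
      OggBound.a₂_not_mem_sq_of_smul hu2 hA₁ hA₂ hA₂n (Ideal.pow_le_pow_right (by omega) hA₃)
        (Ideal.pow_le_pow_right (by omega) hA₄) (Ideal.pow_le_pow_right (by omega) hA₆) hB₁ hB₂
        (Ideal.pow_le_pow_right (by omega) hB₃) (Ideal.pow_le_pow_right (by omega) hB₄)
        (Ideal.pow_le_pow_right (by omega) hB₆)
    have key := Δ_mem_pow_istarIndexAux_of_one_le h2 k 1 V2 le_rfl hB₁ hB₂ hB₂n (by simpa using hB₃)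
      (by simpa using hB₄) (by simpa using hB₆)
    rw [hΔ2] at key
    exact key

/-- **Step 7 in residue characteristic `2`: `π^{n+8} ∣ Δ` for `n = istarIndex V ≠ 1`** (step-6 normalised model whose cubic has
exactly two distinct roots) — the tree's `Δ_mem_pow_istarIndex_of_two_mem` with the sharper loop. [cite: SilvermanATAEC1994, IV.9.4 Step 7] -/
theorem Δ_mem_pow_istarIndex_of_ne_one [PerfectField (ResidueField R)]
    (h2 : (2 : R) ∈ maximalIdeal R) {V : WeierstrassCurve R}
    (h1 : V.a₁ ∈ maximalIdeal R) (h₂ : V.a₂ ∈ maximalIdeal R) (h3 : V.a₃ ∈ maximalIdeal R ^ 2)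
    (h4 : V.a₄ ∈ maximalIdeal R ^ 2) (h6 : V.a₆ ∈ maximalIdeal R ^ 3)
    (hP : distinctRootCount (cubicStep6 V) = 2) (hne : istarIndex V ≠ 1) :
    V.Δ ∈ maximalIdeal R ^ (istarIndex V + 8) := by
  classical
  have hex : ∃ C : WeierstrassCurve.VariableChange R, C.u = 1 ∧
      (C • V).a₁ ∈ maximalIdeal R ∧ (C • V).a₂ ∈ maximalIdeal R ∧ (C • V).a₃ ∈ maximalIdeal R ^ 2 ∧
      (C • V).a₄ ∈ maximalIdeal R ^ 3 ∧ (C • V).a₆ ∈ maximalIdeal R ^ 4 :=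
    exists_variableChange_step7_of_perfectField h1 h₂ h3 h4 h6 hP
  unfold istarIndex at hne ⊢
  dsimp only at hne ⊢
  rw [dif_pos hex] at hne ⊢
  obtain ⟨hu7, hA₁, hA₂, hA₃, hA₄, hA₆⟩ := hex.choose_spec
  set V7 := hex.choose • V with hV7
  have hΔ7 : V7.Δ = V.Δ := Δ_smul_of_u_eq_one hu7 _
  have hA₂n : V7.a₂ ∉ maximalIdeal R ^ 2 := by
    obtain ⟨hr, hs, ht⟩ := OggBound.t_mem_sq_of_smul hu7 h1 h₂ h3 h4 h6 hA₁ hA₂ hA₃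
      (Ideal.pow_le_pow_right (by norm_num) hA₄) (Ideal.pow_le_pow_right (by norm_num) hA₆)
    obtain ⟨c, hc⟩ := OggBound.cubicStep6_smul hu7 h1 h₂ h3 h4 h6 hr hs ht
    intro hA₂2
    obtain ⟨p, hp⟩ := mem_maximalIdeal_iff_dvd.mp hA₂
    obtain ⟨q, hq⟩ := mem_maximalIdeal_pow_iff_dvd.mp hA₄
    obtain ⟨w, hw⟩ := mem_maximalIdeal_pow_iff_dvd.mp hA₆
    have hϖ : residue R (uniformizer R) = 0 :=
      OggBound.residue_eq_zero_of_mem uniformizer_mem_maximalIdeal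
    have hp0 : residue R p = 0 := by
      have h' : uniformizer R ^ 1 * 1 * p ∈ maximalIdeal R ^ (1 + 1) := by
        rw [pow_one, mul_one, ← hp]; exact hA₂2
      have := OggBound.mem_pow_of_uniformizer_pow_mul_mem isUnit_one h'
      rw [pow_one] at this
      exact OggBound.residue_eq_zero_of_mem this
    have hq0 : residue R (uniformizer R * q) = 0 := by rw [map_mul, hϖ, zero_mul]
    have hw0 : residue R (uniformizer R * w) = 0 := by rw [map_mul, hϖ, zero_mul]
    have hcubic7 : cubicStep6 V7 = X ^ 3 + C 0 * X ^ 2 + C 0 * X + C 0 := by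
      rw [cubicStep6_eq (q := uniformizer R * q) (r := uniformizer R * w) hp (by rw [hq]; ring)
        (by rw [hw]; ring), hp0, hq0, hw0]
    have := OggBound.distinctRootCount_comp_X_add_C (cubicStep6 V) c
    rw [← hc, hcubic7, OggBound.distinctRootCount_cube, hP] at this
    exact absurd this (by norm_num)
  have key := Δ_mem_pow_istarIndexAux_zero_of_ne_one h2 (addVal R V.Δ).toNat V7 hA₁ hA₂ hA₂n
    (by simpa using hA₃) (by simpa using hA₄) (by simpa using hA₆) hne
  rw [hΔ7] at key
  exact key

/-- **Output `Iₙ*` with `n ≥ 2` in residue characteristic `2`: `ord Δ ≥ n + 8`** (perfect residue field, `2 ∈ 𝔪`, `Δ ≠ 0`; stated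
for `Istar (n + 2)` as `n + 10 ≤ ord Δ`). [cite: SilvermanATAEC1994, IV.9.4 Step 7] -/
theorem le_addVal_Δ_toNat_of_kodairaSymbolOfMinimal_eq_Istar_succ_succ_of_two_mem
    [PerfectField (ResidueField R)] (h2 : (2 : R) ∈ maximalIdeal R) (V : WeierstrassCurve R)
    (hΔ0 : V.Δ ≠ 0) {n : ℕ} (hV : V.kodairaSymbolOfMinimal = .Istar (n + 2)) :
    n + 10 ≤ (addVal R V.Δ).toNat := by
  classical
  have hϖ : Irreducible (uniformizer R) := irreducible_uniformizer
  unfold WeierstrassCurve.kodairaSymbolOfMinimal at hV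
  obtain ⟨h1, h2', h3, h4, h5, h6, h7, hidx⟩ :=
    (tateTree_eq_Istar_succ_iff _ _ _ _ _ _ _ _ _ _ _ _ _).mp hV
  rw [not_not] at h1 h2' h3 h4 h5
  have hex2 := exists_variableChange_step2_of_perfectField V h1
  have hN2 : normalizeStep2 V = hex2.choose • V := dif_pos hex2
  obtain ⟨hu2, hA₃, hA₄, -⟩ := hex2.choose_spec
  rw [hN2] at h2' h3 h4 h5 h6 h7 hidx
  have hex6 := exists_variableChange_step6_of_perfectField h2' hA₃ hA₄ h3 h5 h4
  have hN6 : normalizeStep6 (hex2.choose • V) = hex6.choose • (hex2.choose • V) :=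
    dif_pos hex6
  obtain ⟨hu6, hB₁, hB₂, hB₃, hB₄, hB₆⟩ := hex6.choose_spec
  rw [hN6] at h6 h7 hidx
  set W₆ := hex6.choose • (hex2.choose • V) with hW₆
  have hΔ6 : W₆.Δ = V.Δ := by rw [hW₆, Δ_smul_of_u_eq_one hu6, Δ_smul_of_u_eq_one hu2]
  have hmem := Δ_mem_pow_istarIndex_of_ne_one h2 hB₁ hB₂ hB₃ hB₄ hB₆ h7 (by rw [hidx]; omega)
  rw [hidx, hΔ6] at hmem
  have := le_addVal_toNat_of_pow_dvd hϖ hΔ0 (mem_maximalIdeal_pow_iff_dvd.mp hmem)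
  omega

end Loop

/-! ## §2 Over a Dedekind domain: `Iₙ*` (`n ≥ 2`) has `f ≥ 4` at `2`; the types with `f = 3` when `2` is a uniformiser -/

section Local

open IsDedekindDomain

variable {A : Type*} [CommRing A] [IsDedekindDomain A] {K : Type*} [Field K] [Algebra A K] [IsFractionRing A K]
  (v : HeightOneSpectrum A) (W : WeierstrassCurve K)

/-- **Type `Iₙ*`, `n ≥ 2`, at a place of residue characteristic `2`: `ord_v(Δ_min) ≥ n + 8`** (stated for `Istar (n + 2)`).
[cite: SilvermanATAEC1994, IV.9.4 Step 7] -/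
theorem le_ordMinimalDiscriminant_of_kodairaSymbolAt_eq_Istar_succ_succ_of_two_mem [W.IsElliptic]
    [PerfectField (IsLocalRing.ResidueField (v.adicCompletionIntegers K))]
    (h2 : (2 : v.adicCompletionIntegers K) ∈ IsLocalRing.maximalIdeal _) {n : ℕ}
    (hT : W.kodairaSymbolAt v = .Istar (n + 2)) : n + 10 ≤ W.ordMinimalDiscriminant v := by
  rw [WeierstrassCurve.kodairaSymbolAt_def] at hT
  exact le_addVal_Δ_toNat_of_kodairaSymbolOfMinimal_eq_Istar_succ_succ_of_two_mem h2 _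
    (W.localMinimalIntegralModel_Δ_ne_zero v) hT

/-- **Type `Iₙ*`, `n ≥ 2`, has `f_v ≥ 4` in residue characteristic `2`** (`f_v = ord_v(Δ_min) + 1 − (n + 5)` is the tree's definition).
[cite: SilvermanATAEC1994, IV.9.4 Step 7 and Table 4.1] -/
theorem four_le_conductorExponent_of_kodairaSymbolAt_eq_Istar_succ_succ_of_two_mem [W.IsElliptic]
    [PerfectField (IsLocalRing.ResidueField (v.adicCompletionIntegers K))]
    (h2 : (2 : v.adicCompletionIntegers K) ∈ IsLocalRing.maximalIdeal _) {n : ℕ}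
    (hT : W.kodairaSymbolAt v = .Istar (n + 2)) : 4 ≤ W.conductorExponent v := by
  have h := le_ordMinimalDiscriminant_of_kodairaSymbolAt_eq_Istar_succ_succ_of_two_mem v W h2 hT
  unfold WeierstrassCurve.conductorExponent WeierstrassCurve.numComponentsAt
  rw [hT, KodairaSymbol.numComponents_Istar]
  omega

/-- **The additive types with `f_v = 3` at an absolutely unramified `2`-adic place are `III` (`ord_v(Δ_min) = 4`), `I₁*` (`8`),
`III*` (`10`) and `II*` (`11`)** (`2` a uniformiser of `O_v`, perfect residue field, `W` elliptic).
[cite: SilvermanATAEC1994, IV.9.4 and Table 4.1] [cite: Papadopoulos1993, Table IV (p = 2)] -/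
theorem kodairaSymbolAt_of_conductorExponent_eq_three_of_irreducible_two [W.IsElliptic]
    [PerfectField (IsLocalRing.ResidueField (v.adicCompletionIntegers K))]
    (h2 : Irreducible (2 : v.adicCompletionIntegers K)) (hf : W.conductorExponent v = 3) :
    (W.kodairaSymbolAt v = .III ∧ W.ordMinimalDiscriminant v = 4) ∨
      (W.kodairaSymbolAt v = .Istar 1 ∧ W.ordMinimalDiscriminant v = 8) ∨
      (W.kodairaSymbolAt v = .IIIstar ∧ W.ordMinimalDiscriminant v = 10) ∨
      (W.kodairaSymbolAt v = .IIstar ∧ W.ordMinimalDiscriminant v = 11) := by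
  have h2m : (2 : v.adicCompletionIntegers K) ∈ IsLocalRing.maximalIdeal _ :=
    (IsLocalRing.mem_maximalIdeal _).mpr h2.not_isUnit
  have hadd : (W.kodairaSymbolAt v).IsAdditive :=
    (W.isAdditive_kodairaSymbolAt_iff_holds v).mpr ((W.two_le_conductorExponent_iff_holds v).mp (by omega))
  have hΔ0 := W.localMinimalIntegralModel_Δ_ne_zero v
  have hf' := hf
  unfold WeierstrassCurve.conductorExponent WeierstrassCurve.numComponentsAt at hf'
  have hIstar : ∀ n, W.kodairaSymbolAt v = .Istar (n + 2) → False := fun n hT ↦ by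
    have := four_le_conductorExponent_of_kodairaSymbolAt_eq_Istar_succ_succ_of_two_mem v W h2m hT
    omega
  -- types `IV`, `IV*`: `ord Δ = 4`, `8`
  have hIV : W.kodairaSymbolAt v = .IV → W.ordMinimalDiscriminant v = 4 := fun hT ↦ by
    rw [WeierstrassCurve.kodairaSymbolAt_def] at hT
    obtain ⟨D, -, -, -, -, -, hΔ⟩ := LocalIndex.exists_smul_a_of_kodairaSymbolOfMinimal_eq_IV_of_two h2 _ hT
    rw [addVal_Δ_smul_toNat] at hΔ
    exact hΔ
  have hIVs : W.kodairaSymbolAt v = .IVstar → W.ordMinimalDiscriminant v = 8 := fun hT ↦ by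
    rw [WeierstrassCurve.kodairaSymbolAt_def] at hT
    obtain ⟨D, -, -, -, -, -, hΔ⟩ := LocalIndex.exists_smul_a_of_kodairaSymbolOfMinimal_eq_IVstar_of_two h2 _ hT
    rw [addVal_Δ_smul_toNat] at hΔ
    exact hΔ
  generalize hT : W.kodairaSymbolAt v = T at hadd hf' hIstar hIV hIVs
  have hV : (W.localMinimalIntegralModel v).kodairaSymbolOfMinimal = T := by
    rw [← WeierstrassCurve.kodairaSymbolAt_def]; exact hT
  cases T with
  | I n => exact absurd hadd (KodairaSymbol.not_isAdditive_I n)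
  | II =>
    exfalso
    have h := LocalIndex.addVal_Δ_toNat_eq_of_kodairaSymbolOfMinimal_eq_II_of_two h2 _ hV
    change W.ordMinimalDiscriminant v = 4 ∨ W.ordMinimalDiscriminant v = 6 ∨ W.ordMinimalDiscriminant v = 7 at h
    rw [show KodairaSymbol.numComponents .II = 1 from rfl] at hf'
    omega
  | III =>
    have h := LocalIndex.addVal_Δ_toNat_eq_of_kodairaSymbolOfMinimal_eq_III_of_two h2 _ hV
    change W.ordMinimalDiscriminant v = 4 ∨ W.ordMinimalDiscriminant v = 6 ∨ W.ordMinimalDiscriminant v = 8 ∨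
      W.ordMinimalDiscriminant v = 9 at h
    rw [show KodairaSymbol.numComponents .III = 2 from rfl] at hf'
    exact Or.inl ⟨rfl, by omega⟩
  | IV =>
    exfalso
    have h := hIV rfl
    rw [show KodairaSymbol.numComponents .IV = 3 from rfl] at hf'
    omega
  | Istar n =>
    cases n with
    | zero =>
      exfalso
      have h := LocalIndex.addVal_Δ_toNat_eq_of_kodairaSymbolOfMinimal_eq_Istar_zero_of_two h2 _ hΔ0 hV
      change W.ordMinimalDiscriminant v = 8 ∨ W.ordMinimalDiscriminant v = 9 ∨ W.ordMinimalDiscriminant v = 10 at h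
      rw [show KodairaSymbol.numComponents (.Istar 0) = 5 from rfl] at hf'
      omega
    | succ n =>
      cases n with
      | zero =>
        rw [show KodairaSymbol.numComponents (.Istar (0 + 1)) = 6 from rfl] at hf'
        exact Or.inr (Or.inl ⟨rfl, by omega⟩)
      | succ n => exact absurd rfl (fun h ↦ hIstar n h)
  | IVstar =>
    exfalso
    have h := hIVs rfl
    rw [show KodairaSymbol.numComponents .IVstar = 7 from rfl] at hf'
    omega
  | IIIstar =>
    have h := LocalIndex.addVal_Δ_toNat_eq_of_kodairaSymbolOfMinimal_eq_IIIstar_of_two h2 _ hV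
    change W.ordMinimalDiscriminant v = 10 ∨ W.ordMinimalDiscriminant v = 12 ∨ W.ordMinimalDiscriminant v = 14 ∨
      W.ordMinimalDiscriminant v = 15 at h
    rw [show KodairaSymbol.numComponents .IIIstar = 8 from rfl] at hf'
    exact Or.inr (Or.inr (Or.inl ⟨rfl, by omega⟩))
  | IIstar =>
    have h := LocalIndex.addVal_Δ_toNat_eq_of_kodairaSymbolOfMinimal_eq_IIstar_of_two h2 _ hV
    change W.ordMinimalDiscriminant v = 11 ∨ W.ordMinimalDiscriminant v = 12 ∨ W.ordMinimalDiscriminant v = 14 at h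
    rw [show KodairaSymbol.numComponents .IIstar = 9 from rfl] at hf'
    exact Or.inr (Or.inr (Or.inr ⟨rfl, by omega⟩))

end Local

/-! ## §3 Over `ℚ` at the place of `ℤ` above `2` -/

section Rat

open IsDedekindDomain

/-- Over `ℚ`: if the prime below `v` is `2` then `2` is a uniformiser of `O_v ≃ ℤ₂`. [folklore] -/
theorem irreducible_two_adicCompletionIntegers_of_natGenerator_eq_two (v : HeightOneSpectrum ℤ)
    (hv : Rat.HeightOneSpectrum.natGenerator v = 2) : Irreducible (2 : v.adicCompletionIntegers ℚ) := by
  have h := Literature.NumberTheory.DiophantineGeometry.Rat.irreducible_natCast_natGenerator v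
  rw [hv] at h
  simpa using h

/-- **`f₂ = 3` over `ℚ` forces `III` with `ord₂(Δ_min) = 4`, `I₁*` with `8`, `III*` with `10`, or `II*` with `11`** (place `v` of `ℤ`
above `2`). [cite: SilvermanATAEC1994, IV.9.4 and Table 4.1] [cite: Papadopoulos1993, Table IV (p = 2)] -/
theorem kodairaSymbolAt_of_conductorExponent_eq_three_two (W : WeierstrassCurve ℚ) [W.IsElliptic] (v : HeightOneSpectrum ℤ)
    (hv : Rat.HeightOneSpectrum.natGenerator v = 2) (hf : W.conductorExponent v = 3) :
    (W.kodairaSymbolAt v = .III ∧ W.ordMinimalDiscriminant v = 4) ∨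
      (W.kodairaSymbolAt v = .Istar 1 ∧ W.ordMinimalDiscriminant v = 8) ∨
      (W.kodairaSymbolAt v = .IIIstar ∧ W.ordMinimalDiscriminant v = 10) ∨
      (W.kodairaSymbolAt v = .IIstar ∧ W.ordMinimalDiscriminant v = 11) :=
  kodairaSymbolAt_of_conductorExponent_eq_three_of_irreducible_two v W
    (irreducible_two_adicCompletionIntegers_of_natGenerator_eq_two v hv) hf

end Rat

end Summit.BirchSwinnertonDyer.BirchSwinnertonDyer.Theorems.ManinLocalTwoThree

end
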